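import Summits.Schanuel.Schanuel.Theses.TateNomes
import Literature.NumberTheory.Transcendental.RankOneGridTrdeg
import HarnessLib

/-!
# Stub `stub_algPairCost` — line `trdeg-bookkeeping` of crux `NomeTransfer` (route `TateNomes`)

Registered stub 3 of the skeleton for `Summit.Schanuel.Schanuel.Theses.TateNomes.NomeTransfer`
(item stmt-Schanuel-17405): **admissible pairs cost at most one each**. If for every `i` either
`eᵢ` or `exp eᵢ` is algebraic over `ℚ`, then

  `trdeg_ℚ ℚ(z, e, e^z, e^e) ≤ trdeg_ℚ ℚ(z, e^z) + k`  (`e : Fin k → ℂ`).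

Proof (folklore bookkeeping, no transcendence input). Let `Z = range z ∪ range (exp ∘ z)`, let
`bᵢ` be the *partner* of the algebraic member of the pair (`bᵢ = exp eᵢ` if `eᵢ` is algebraic,
`bᵢ = eᵢ` otherwise) and `A = {x ∈ ℂ | x algebraic over ℚ}`. Then
`range z ∪ range e ∪ range (exp ∘ z) ∪ range (exp ∘ e) ⊆ (Z ∪ range b) ∪ A`, so

  `trdeg ℚ(z, e, e^z, e^e) ≤ trdeg ℚ((Z ∪ range b) ∪ A)`   (monotonicity, `trdeg_mono`)
  `= trdeg ℚ(Z ∪ range b)`                                 (`A` algebraic, `trdeg_adjoin_union_eq_of_isAlgebraic`)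
  `≤ trdeg ℚ(Z) + trdeg ℚ(range b)`                        (subadditivity, `trdeg_adjoin_union_le`)
  `≤ trdeg ℚ(Z) + #(range b) ≤ trdeg ℚ(Z) + k`              (`trdeg_adjoin_le_mk`, `Cardinal.mk_range_le`).

## Contents

* `stub_algPairCost` — the registered stub, verbatim (uncurried `∀`-form).
* `algPairCost` — curried corollary.
-/

noncomputable section

-- D-0017: the doubled Schanuel.Schanuel path component is the mandated summit/sub-problem namespace
set_option linter.dupNamespace false

namespace Summit.Schanuel.Schanuel.Theorems.TateNomesNomeTransfer

open Complex IntermediateField Cardinal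
open Literature.Barriers.Schanuel (trdeg_mono trdeg_adjoin_union_eq_of_isAlgebraic)
open Literature.NumberTheory.Transcendental (trdeg_adjoin_union_le trdeg_adjoin_le_mk)

-- Note on the `ℚ`-algebra diamond on subfields of `ℂ` (`DivisionRing.toRatAlgebra`, found here by
-- instance search, vs the generic `IntermediateField.algebra` of the imported lemmas): the two are
-- defeq, so the generic lemmas are applied by unification (`calc` steps / `exact`), never with `rw`.

/-- **Admissible pairs cost at most one each** (registered stub `stub_algPairCost` of line
`trdeg-bookkeeping`, crux `NomeTransfer`). If each `eᵢ` or `exp eᵢ` is algebraic over `ℚ`, then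
`trdeg_ℚ ℚ(z, e, e^z, e^e) ≤ trdeg_ℚ ℚ(z, e^z) + k`: with `bᵢ` the partner of the algebraic member
of the `i`-th pair and `A` the set of algebraic numbers, the generators lie in
`(range z ∪ range (exp ∘ z) ∪ range b) ∪ A`; adjoining `A` is free and `range b` costs `≤ #(range b) ≤ k`.
[folklore] -/
theorem stub_algPairCost :
    ∀ (n k : ℕ) (z : Fin n → ℂ) (e : Fin k → ℂ),
      (∀ i, IsAlgebraic ℚ (e i) ∨ IsAlgebraic ℚ (Complex.exp (e i))) →
      Algebra.trdeg ℚ ↥(IntermediateField.adjoin ℚ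
          (Set.range z ∪ Set.range e ∪ (Set.range (Complex.exp ∘ z) ∪ Set.range (Complex.exp ∘ e)))) ≤
        Algebra.trdeg ℚ ↥(IntermediateField.adjoin ℚ (Set.range z ∪ Set.range (Complex.exp ∘ z))) +
          (k : Cardinal) := by
  intro n k z e he
  classical
  -- the partner family: the non-(necessarily-)algebraic member of each admissible pair
  obtain ⟨b, hb⟩ : ∃ b : Fin k → ℂ, ∀ i, b i = if IsAlgebraic ℚ (e i) then cexp (e i) else e i :=
    ⟨_, fun _ => rfl⟩
  -- every generator is in `Z ∪ range b` or algebraic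
  have hsub : Set.range z ∪ Set.range e ∪ (Set.range (cexp ∘ z) ∪ Set.range (cexp ∘ e)) ⊆
      (Set.range z ∪ Set.range (cexp ∘ z) ∪ Set.range b) ∪ {x : ℂ | IsAlgebraic ℚ x} := by
    rintro x ((⟨i, rfl⟩ | ⟨i, rfl⟩) | (⟨i, rfl⟩ | ⟨i, rfl⟩))
    · exact Or.inl (Or.inl (Or.inl ⟨i, rfl⟩))
    · by_cases hi : IsAlgebraic ℚ (e i)
      · exact Or.inr hi
      · exact Or.inl (Or.inr ⟨i, (hb i).trans (if_neg hi)⟩)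
    · exact Or.inl (Or.inl (Or.inr ⟨i, rfl⟩))
    · by_cases hi : IsAlgebraic ℚ (e i)
      · exact Or.inl (Or.inr ⟨i, (hb i).trans (if_pos hi)⟩)
      · exact Or.inr ((he i).resolve_left hi)
  -- `trdeg ℚ(range b) ≤ #(range b) ≤ #(Fin k) = k`
  have hb_le : Algebra.trdeg ℚ ↥(adjoin ℚ (Set.range b)) ≤ (k : Cardinal) :=
    (trdeg_adjoin_le_mk _).trans (Cardinal.mk_range_le.trans_eq (Cardinal.mk_fin k))
  calc Algebra.trdeg ℚ ↥(adjoin ℚ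
          (Set.range z ∪ Set.range e ∪ (Set.range (cexp ∘ z) ∪ Set.range (cexp ∘ e))))
      ≤ Algebra.trdeg ℚ ↥(adjoin ℚ
          ((Set.range z ∪ Set.range (cexp ∘ z) ∪ Set.range b) ∪ {x : ℂ | IsAlgebraic ℚ x})) :=
        trdeg_mono (adjoin.mono ℚ _ _ hsub)
    _ = Algebra.trdeg ℚ ↥(adjoin ℚ (Set.range z ∪ Set.range (cexp ∘ z) ∪ Set.range b)) :=
        trdeg_adjoin_union_eq_of_isAlgebraic _ _ fun _ hx => hx
    _ ≤ Algebra.trdeg ℚ ↥(adjoin ℚ (Set.range z ∪ Set.range (cexp ∘ z))) +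
          Algebra.trdeg ℚ ↥(adjoin ℚ (Set.range b)) :=
        trdeg_adjoin_union_le _ _
    _ ≤ Algebra.trdeg ℚ ↥(adjoin ℚ (Set.range z ∪ Set.range (cexp ∘ z))) + (k : Cardinal) := by
        gcongr

/-- Curried form of `stub_algPairCost`: if each `eᵢ` or `exp eᵢ` is algebraic over `ℚ`, then
`trdeg_ℚ ℚ(z, e, e^z, e^e) ≤ trdeg_ℚ ℚ(z, e^z) + k`. [folklore] -/
theorem algPairCost {n k : ℕ} (z : Fin n → ℂ) {e : Fin k → ℂ}
    (he : ∀ i, IsAlgebraic ℚ (e i) ∨ IsAlgebraic ℚ (Complex.exp (e i))) :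
    Algebra.trdeg ℚ ↥(IntermediateField.adjoin ℚ
        (Set.range z ∪ Set.range e ∪ (Set.range (Complex.exp ∘ z) ∪ Set.range (Complex.exp ∘ e)))) ≤
      Algebra.trdeg ℚ ↥(IntermediateField.adjoin ℚ (Set.range z ∪ Set.range (Complex.exp ∘ z))) +
        (k : Cardinal) :=
  stub_algPairCost n k z e he

end Summit.Schanuel.Schanuel.Theorems.TateNomesNomeTransfer

end
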